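import Mathlib.MeasureTheory.Constructions.Pi
import Mathlib.MeasureTheory.Integral.Prod
import Mathlib.MeasureTheory.Measure.Typeclasses.Probability
import Mathlib.Analysis.Complex.Basic
import HarnessLib

/-!
# Functions of disjoint sets of links are independent under a product reference measure (complex-valued, update form)

HONEST FRAMING: exact (Metropolis-corrected) sampling algorithms for lattice gauge theory;
figures of merit are autocorrelation/cost numbers at stated couplings and volumes; no
continuum-physics claim.

Venture `LatticeQCDFlow` (cell pub-lqcd), sub-topic `Scoring`; FANOUT row 5 (`s0-sun-a`), GEN-22.
NEW WORK of the cell (placement rule); Mathlib-only tools for part VIII of the two-dimensional area-law series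
(`FreeBoundaryIndependence2D`: local observables a column apart are exactly independent under the free-boundary
lattice Yang–Mills measure).  For a finite index type `ι` (the links), a measurable space `Y` (the gauge group)
and the product `ν^{⊗ι}` of a probability measure (product Haar measure):

* `eq_of_forall_update_eq` — a function unchanged by updating any coordinate outside `D` depends on the
  coordinates in `D` only;
* `integral_pi_mul_split_complex` — complex-valued form of the block factorisation
  `∫ a(x|_P) b(x|_{¬P}) dν^{⊗ι} = ∫ a dν^{⊗P} · ∫ b dν^{⊗¬P}` (`MeasurableEquiv.piEquivPiSubtypeProd`; the
  real-valued form is `Literature.Analysis.OperatorTheory.integral_pi_mul_split`);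
* **`integral_mul_eq_mul_of_forall_update`** — if `f` is unchanged by updating any coordinate outside `D` and
  `g` by updating any coordinate inside `D`, then `∫ f g dν^{⊗ι} = ∫ f dν^{⊗ι} · ∫ g dν^{⊗ι}` (complex-valued;
  the hypothesis shape in which the area-law series states locality: `Φ (update U e g) = Φ U`).

No `def`, nothing cited as a fact, 0 sorry.
-/

noncomputable section

open MeasureTheory Function

namespace Summit.Ventures.LatticeQCDFlow.Scoring

variable {ι : Type*} [Fintype ι] {Y : Type*}

/-- **Update-invariance off `D` is dependence on `D` only**: if `f (update x i y) = f x` for every `i ∉ D`, then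
`f` takes the same value on any two points agreeing on `D`. -/
theorem eq_of_forall_update_eq [DecidableEq ι] {α : Type*} (D : Finset ι) (f : (ι → Y) → α)
    (hf : ∀ i ∉ D, ∀ (x : ι → Y) (y : Y), f (update x i y) = f x) (x x' : ι → Y)
    (hxx' : ∀ i ∈ D, x i = x' i) : f x' = f x := by
  have key : ∀ s : Finset ι, f (fun i => if i ∈ s then x' i else x i) = f x := by
    intro s
    induction s using Finset.induction_on with
    | empty => simp
    | insert a s ha ih =>
      have hfun : (fun i => if i ∈ insert a s then x' i else x i) =
          update (fun i => if i ∈ s then x' i else x i) a (x' a) := by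
        funext i
        by_cases hi : i = a
        · subst hi; simp
        · rw [update_of_ne hi]; simp [Finset.mem_insert, hi]
      rw [hfun]
      by_cases haD : a ∈ D
      · have : x' a = (fun i => if i ∈ s then x' i else x i) a := by simp [ha, hxx' a haD]
        rw [this, update_eq_self, ih]
      · rw [hf a haD, ih]
  simpa using key Finset.univ

variable [MeasurableSpace Y]

/-- Complex-valued block factorisation under a product measure: a function of the coordinates in `{i | P i}`
times a function of the other coordinates integrates to the product of the integrals. -/
theorem integral_pi_mul_split_complex (P : ι → Prop) [DecidablePred P] (ν : Measure Y) [SigmaFinite ν]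
    (a : ({i // P i} → Y) → ℂ) (b : ({i // ¬P i} → Y) → ℂ) :
    ∫ x : ι → Y, a (fun i => x i) * b (fun i => x i) ∂(Measure.pi fun _ => ν) =
      (∫ z, a z ∂(Measure.pi fun _ => ν)) * ∫ z, b z ∂(Measure.pi fun _ => ν) := by
  have h := measurePreserving_piEquivPiSubtypeProd (fun _ : ι => ν) P
  rw [← integral_prod_mul a b, ← h.integral_comp' (g := fun z => a z.1 * b z.2)]
  rfl

/-- **FUNCTIONS OF DISJOINT COORDINATE SETS ARE INDEPENDENT under a product probability measure** (update
form, complex-valued): if `f` is unchanged by updating any coordinate outside `D` and `g` by updating any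
coordinate inside `D`, then `∫ f g dν^{⊗ι} = ∫ f dν^{⊗ι} · ∫ g dν^{⊗ι}`. -/
theorem integral_mul_eq_mul_of_forall_update [DecidableEq ι] (ν : Measure Y) [IsProbabilityMeasure ν] (D : Finset ι)
    (f g : (ι → Y) → ℂ) (hf : ∀ i ∉ D, ∀ (x : ι → Y) (y : Y), f (update x i y) = f x)
    (hg : ∀ i ∈ D, ∀ (x : ι → Y) (y : Y), g (update x i y) = g x) :
    ∫ x, f x * g x ∂(Measure.pi fun _ : ι => ν) =
      (∫ x, f x ∂(Measure.pi fun _ : ι => ν)) * ∫ x, g x ∂(Measure.pi fun _ : ι => ν) := by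
  classical
  obtain ⟨y₀⟩ := nonempty_of_isProbabilityMeasure ν
  set a : ({i // i ∈ D} → Y) → ℂ := fun z => f fun i => if h : i ∈ D then z ⟨i, h⟩ else y₀ with ha
  set b : ({i // ¬ i ∈ D} → Y) → ℂ := fun z => g fun i => if h : i ∈ D then y₀ else z ⟨i, h⟩ with hb
  have hfa : ∀ x : ι → Y, f x = a fun i => x i := fun x =>
    eq_of_forall_update_eq D f hf _ x fun i hi => by simp [hi]
  have hgb : ∀ x : ι → Y, g x = b fun i => x i := fun x =>
    eq_of_forall_update_eq Dᶜ g (fun i hi => hg i (by simpa using hi)) _ x fun i hi => by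
      have hi' : i ∉ D := by simpa using hi
      simp [hi']
  have h1 : (fun x : ι → Y => f x * g x) = fun x => a (fun i => x i) * b (fun i => x i) :=
    funext fun x => by rw [hfa x, hgb x]
  have h2 : (fun x : ι → Y => f x) = fun x => a (fun i => x i) * (fun _ => (1 : ℂ)) (fun i => x i) :=
    funext fun x => by rw [hfa x]; simp
  have h3 : (fun x : ι → Y => g x) = fun x => (fun _ => (1 : ℂ)) (fun i => x i) * b (fun i => x i) :=
    funext fun x => by rw [hgb x]; simp
  rw [h1, h2, h3, integral_pi_mul_split_complex (· ∈ D) ν a b,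
    integral_pi_mul_split_complex (· ∈ D) ν a (fun _ => 1),
    integral_pi_mul_split_complex (· ∈ D) ν (fun _ => 1) b]
  simp

end Summit.Ventures.LatticeQCDFlow.Scoring
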